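import Literature.MathematicalPhysics.KineticTheory.ConfinedForcedFlow
import Literature.Probability.Process.BrownianPair
import Literature.Probability.Process.PathRegularization
import Mathlib.Probability.Kernel.Composition.Comp
import HarnessLib

/-!
# Additive-noise SDEs driven by a Brownian pair: transition kernels, Feller property, Chapman–Kolmogorov

Trunk T-KINETIC (Literature/MathematicalPhysics/KineticTheory). Model-free version of
`LangevinChainKernel.lean` (same proofs), on top of the pathwise flow of `ConfinedForcedFlow.lean`:
for a confined drift `D : ConfinedDrift Y` on a finite-dimensional space `E` and two vectors
`v₁, v₂` of its noise subspace, the SDE `dz = Y(z) dt + v₁ dB¹ + v₂ dB²` driven by the pair of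
independent Brownian motions of `Literature/Probability/Process/BrownianPair.lean` (Langevin
chains with two heat baths, CEHR (2.2); Rey-Bellet–Thomas (RBT-SDE) with two reservoirs):

* `pairNoise v₁ v₂ w` — the noise path `n(t) = (w̄₁(t⁺) - w̄₁(0)) v₁ + (w̄₂(t⁺) - w̄₂(0)) v₂` of a
  pair of RAW paths `w` through the measurable regularisation `pathRegularize` (continuous in `t`
  for every `w`, measurable in `w`, `n(0) = 0`, values in `span{v₁, v₂}`; on the Brownian pair it is
  `B¹_{t⁺} v₁ + B²_{t⁺} v₂`, and the noise of the shifted pair is the shifted noise).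
* `sdeSolMap Y v₁ v₂ t x w = drivenFlow Y x (pairNoise v₁ v₂ w) t` — the solution map; under `D`:
  jointly measurable in `(t, x, w)`, continuous in `t` and in `x`, `Φ₀ = id`, and the cocycle through
  the shift of the pair `Φ_{s+t}(x, B(ω)) = Φ_t(Φ_s(x, B(ω)), θ_s ω)`.
* `sdeKernel Y v₁ v₂ t` — the transition kernel `P_t(x, ·) = law(Φ_t(x, B))` (documented junk: the
  zero kernel when the solution map is not measurable, never the case under `D`). Under `D`:
  Markov kernels, jointly measurable in `(t, x)`, `P_0 = id`, `P^t g(x) = E g(Φ_t(x, B))`, the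
  **Feller property** (`ConfinedDrift.continuous_integral_sdeKernel`), past-measurability of
  `Φ_s(x, B)` and **Chapman–Kolmogorov `P_{s+t} = P_t ∘ₖ P_s`** (`ConfinedDrift.sdeKernel_add`) from
  the cocycle property and the weak Markov property of the pair
  (`Literature.Probability.Process.lintegral_comp_pairShift_eq`).

## References

* D. Revuz, M. Yor, *Continuous Martingales and Brownian Motion* (3rd ed., 1999), Ch. III §1,
  Ch. IX §1.
* R. Khasminskii, *Stochastic Stability of Differential Equations* (2nd ed., 2012), §3.4.
* L. Rey-Bellet, L. E. Thomas, Comm. Math. Phys. **225** (2002) 305–329, §2 ("The solution `x(t)`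
  of Eq. (12) is a Markov process").
-/

noncomputable section

open MeasureTheory ProbabilityTheory Filter Topology Set
open scoped NNReal ENNReal

namespace Literature.MathematicalPhysics.KineticTheory

open Literature.Probability.Process Literature.Analysis.ODE

variable {E : Type*} [NormedAddCommGroup E] [NormedSpace ℝ E]

/-! ### The noise path of a pair of driving paths -/

/-- The **noise path** of the SDE driven by the pair of raw paths `w = (w₁, w₂)` along the vectors
`v₁, v₂`: `n(t) = (w̄₁(t⁺) - w̄₁(0)) v₁ + (w̄₂(t⁺) - w̄₂(0)) v₂`, `w̄ = pathRegularize w` the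
measurable regularisation (the identity on continuous paths), `t⁺ = max(t, 0)`. Continuous in `t`
for EVERY `w`, measurable in `w`, `n(0) = 0`. [folklore] -/
def pairNoise (v₁ v₂ : E) (w : WienerPair) (t : ℝ) : E :=
  (pathRegularize w.1 t.toNNReal - pathRegularize w.1 0) • v₁ +
    (pathRegularize w.2 t.toNNReal - pathRegularize w.2 0) • v₂

section Noise

variable (v₁ v₂ : E)

/-- `n(0) = 0`. [folklore] -/
@[simp] theorem pairNoise_zero (w : WienerPair) : pairNoise v₁ v₂ w 0 = 0 := by
  simp [pairNoise]

/-- `n(t) = 0` for `t ≤ 0`. [folklore] -/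
theorem pairNoise_of_nonpos (w : WienerPair) {t : ℝ} (ht : t ≤ 0) : pairNoise v₁ v₂ w t = 0 := by
  simp [pairNoise, Real.toNNReal_of_nonpos ht]

/-- The noise path is continuous in time, for every pair of raw paths. [folklore] -/
theorem continuous_pairNoise (w : WienerPair) : Continuous (pairNoise v₁ v₂ w) := by
  have h1 := continuous_pathRegularize_toNNReal (E := ℝ) w.1
  have h2 := continuous_pathRegularize_toNNReal (E := ℝ) w.2
  unfold pairNoise
  fun_prop

/-- The noise path takes values in the span of `v₁, v₂`: in any submodule containing both.
[folklore] -/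
theorem pairNoise_mem {S : Submodule ℝ E} (h₁ : v₁ ∈ S) (h₂ : v₂ ∈ S) (w : WienerPair) (t : ℝ) :
    pairNoise v₁ v₂ w t ∈ S :=
  S.add_mem (S.smul_mem _ h₁) (S.smul_mem _ h₂)

variable [MeasurableSpace E] [BorelSpace E] [SecondCountableTopology E]

/-- The noise path at a fixed time is a measurable function of the pair of raw paths. [folklore] -/
@[fun_prop]
theorem measurable_pairNoise (t : ℝ) : Measurable fun w : WienerPair => pairNoise v₁ v₂ w t := by
  unfold pairNoise
  have h1 : ∀ u : ℝ≥0, Measurable fun w : WienerPair => pathRegularize w.1 u := fun u =>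
    (measurable_pathRegularize u).comp measurable_fst
  have h2 : ∀ u : ℝ≥0, Measurable fun w : WienerPair => pathRegularize w.2 u := fun u =>
    (measurable_pathRegularize u).comp measurable_snd
  exact (((h1 _).sub (h1 0)).smul_const v₁).add (((h2 _).sub (h2 0)).smul_const v₂)

omit [MeasurableSpace E] [BorelSpace E] [SecondCountableTopology E] in
/-- On a pair of CONTINUOUS paths the noise is read off the paths themselves. [folklore] -/
theorem pairNoise_of_continuous {w : WienerPair} (h1 : Continuous w.1) (h2 : Continuous w.2) (t : ℝ) :
    pairNoise v₁ v₂ w t = (w.1 t.toNNReal - w.1 0) • v₁ + (w.2 t.toNNReal - w.2 0) • v₂ := by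
  simp only [pairNoise, pathRegularize_eq_self_of_continuous h1, pathRegularize_eq_self_of_continuous h2]

omit [MeasurableSpace E] [BorelSpace E] [SecondCountableTopology E] in
/-- The noise of the pair of Brownian paths `pairPath ω`: `n(t) = B_{t⁺}(ω₁) v₁ + B_{t⁺}(ω₂) v₂`.
[folklore] -/
theorem pairNoise_pairPath (ω : WienerPair) (t : ℝ) :
    pairNoise v₁ v₂ (pairPath ω) t = brownian t.toNNReal ω.1 • v₁ + brownian t.toNNReal ω.2 • v₂ := by
  rw [pairNoise_of_continuous v₁ v₂ (continuous_pairPath_fst ω) (continuous_pairPath_snd ω)]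
  simp [pairPath]

omit [MeasurableSpace E] [BorelSpace E] [SecondCountableTopology E] in
/-- The noise of the shifted pair `pairShift s ω` is the shifted noise of `pairPath ω` on `t ≥ 0`:
`n(θ_s ω)(t) = n(ω)(s + t) - n(ω)(s)`. [folklore] -/
theorem pairNoise_pairShift (s : ℝ≥0) (ω : WienerPair) {t : ℝ} (ht : 0 ≤ t) :
    pairNoise v₁ v₂ (pairShift s ω) t =
      pairNoise v₁ v₂ (pairPath ω) (s + t) - pairNoise v₁ v₂ (pairPath ω) s := by
  rw [pairNoise_of_continuous v₁ v₂ (continuous_pairShift_fst (s := s) ω)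
    (continuous_pairShift_snd (s := s) ω), pairNoise_pairPath, pairNoise_pairPath]
  have hst : ((s : ℝ) + t).toNNReal = s + t.toNNReal := by
    rw [Real.toNNReal_add s.coe_nonneg ht, Real.toNNReal_coe]
  simp only [pairShift, hst, Real.toNNReal_coe, add_zero, sub_self, sub_smul, sub_zero]
  abel

end Noise

/-! ### The solution map and the transition kernel (definitions) -/

section Defs

variable [CompleteSpace E] [MeasurableSpace E]

/-- The **solution map** `Φ_t(x, w)`: the pathwise solution `drivenFlow` (`ConfinedForcedFlow.lean`)
at time `t`, started at `x`, driven by the noise `pairNoise v₁ v₂ w` of the pair of raw paths `w`.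
[folklore] -/
def sdeSolMap (Y : E → E) (v₁ v₂ : E) (t : ℝ) (x : E) (w : WienerPair) : E :=
  drivenFlow Y x (pairNoise v₁ v₂ w) t

open Classical in
/-- The **transition kernel** `P_t(x, ·) = law of Φ_t(x, B)`, `B = pairPath ω` the pair of independent
Brownian paths under `wienerPair`. **Junk value**: the zero kernel if the solution map is not
jointly measurable in `(x, ω)` — never the case for a confined drift
(`ConfinedDrift.sdeKernel_apply`). [folklore] -/
def sdeKernel (Y : E → E) (v₁ v₂ : E) (t : ℝ≥0) : Kernel E E :=
  if h : Measurable fun p : E × WienerPair => sdeSolMap Y v₁ v₂ t p.1 (pairPath p.2) then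
    { toFun := fun x => wienerPair.map fun ω => sdeSolMap Y v₁ v₂ t x (pairPath ω)
      measurable' := by
        refine Measure.measurable_of_measurable_coe _ fun A hA => ?_
        have hx : (fun x => (wienerPair.map fun ω => sdeSolMap Y v₁ v₂ t x (pairPath ω)) A) =
            fun x => wienerPair (Prod.mk x ⁻¹'
              ((fun p : E × WienerPair => sdeSolMap Y v₁ v₂ t p.1 (pairPath p.2)) ⁻¹' A)) := by
          funext x
          have hx := h.comp (measurable_prodMk_left (x := x))
          have hx' : Measurable fun ω => sdeSolMap Y v₁ v₂ t x (pairPath ω) := hx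
          rw [Measure.map_apply hx' hA]
          rfl
        rw [hx]
        exact measurable_measure_prodMk_left (h hA) }
  else 0

end Defs

/-! ### Under a confined drift: measurability and continuity of the solution map -/

namespace ConfinedDrift

variable [FiniteDimensional ℝ E] [CompleteSpace E] [MeasurableSpace E] [BorelSpace E]
  [SecondCountableTopology E] {Y : E → E} (D : ConfinedDrift Y) {v₁ v₂ : E}
  (hv₁ : v₁ ∈ D.noise) (hv₂ : v₂ ∈ D.noise)
include D hv₁ hv₂

/-- The solution map is jointly measurable in `(x, w)`. [folklore] -/
theorem measurable_sdeSolMap (t : ℝ) :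
    Measurable fun p : E × WienerPair => sdeSolMap Y v₁ v₂ t p.1 p.2 := by
  unfold sdeSolMap
  exact D.measurable_flow (X := fun p : E × WienerPair => p.1)
    (G := fun p : E × WienerPair => pairNoise v₁ v₂ p.2) measurable_fst
    (fun p => continuous_pairNoise _ _ p.2) (fun p t => pairNoise_mem v₁ v₂ hv₁ hv₂ p.2 t)
    (fun u => (measurable_pairNoise _ _ u).comp measurable_snd) t

/-- The solution map driven by the Brownian pair is jointly measurable in `(x, ω)`. [folklore] -/
theorem measurable_sdeSolMap_pairPath (t : ℝ) :
    Measurable fun p : E × WienerPair => sdeSolMap Y v₁ v₂ t p.1 (pairPath p.2) := by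
  have h2 : Measurable fun p : E × WienerPair => (p.1, pairPath p.2) :=
    measurable_fst.prodMk (measurable_pairPath.comp measurable_snd)
  have h := (D.measurable_sdeSolMap hv₁ hv₂ t).comp h2
  exact h

/-- For fixed `x`, `ω ↦ Φ_t(x, pairPath ω)` is measurable. [folklore] -/
theorem measurable_sdeSolMap_pairPath_right (t : ℝ) (x : E) :
    Measurable fun ω : WienerPair => sdeSolMap Y v₁ v₂ t x (pairPath ω) := by
  have h := (D.measurable_sdeSolMap_pairPath hv₁ hv₂ t).comp (measurable_prodMk_left (x := x))
  exact h

omit [MeasurableSpace E] [BorelSpace E] [SecondCountableTopology E] in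
/-- The solution map is continuous in time. [folklore] -/
theorem continuous_sdeSolMap (x : E) (w : WienerPair) : Continuous fun t => sdeSolMap Y v₁ v₂ t x w := by
  unfold sdeSolMap
  exact D.continuous_flow x (continuous_pairNoise _ _ w) (pairNoise_mem v₁ v₂ hv₁ hv₂ w)

omit [MeasurableSpace E] [BorelSpace E] [SecondCountableTopology E] in
/-- The solution map is continuous in the initial condition. [folklore] -/
theorem continuous_sdeSolMap_left (t : ℝ) (w : WienerPair) : Continuous fun x => sdeSolMap Y v₁ v₂ t x w := by
  unfold sdeSolMap
  exact D.continuous_flow_left (continuous_pairNoise _ _ w) (pairNoise_mem v₁ v₂ hv₁ hv₂ w) t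

/-- The solution map is jointly measurable in `(t, x, w)`. [folklore] -/
theorem measurable_uncurry_sdeSolMap :
    Measurable fun p : ℝ × (E × WienerPair) => sdeSolMap Y v₁ v₂ p.1 p.2.1 p.2.2 := by
  have h := measurable_uncurry_of_continuous_of_measurable
    (u := fun (t : ℝ) (p : E × WienerPair) => sdeSolMap Y v₁ v₂ t p.1 p.2)
    (fun p => D.continuous_sdeSolMap hv₁ hv₂ p.1 p.2) (D.measurable_sdeSolMap hv₁ hv₂)
  exact h

omit [MeasurableSpace E] [BorelSpace E] [SecondCountableTopology E] hv₁ hv₂ in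
/-- At time `0` (and before) the solution map is the initial condition. [folklore] -/
theorem sdeSolMap_of_nonpos (x : E) (w : WienerPair) {t : ℝ} (ht : t ≤ 0) :
    sdeSolMap Y v₁ v₂ t x w = x := by
  unfold sdeSolMap
  rw [D.flow_of_nonpos x (continuous_pairNoise _ _ w) ht, pairNoise_zero, add_zero]

omit [MeasurableSpace E] [BorelSpace E] [SecondCountableTopology E] in
/-- **The cocycle property through the shift of the Brownian pair**: for `s, t ≥ 0`,
`Φ_{s+t}(x, B(ω)) = Φ_t(Φ_s(x, B(ω)), θ_s ω)`. [folklore] -/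
theorem sdeSolMap_add_pairPath (s : ℝ≥0) {t : ℝ} (ht : 0 ≤ t) (x : E) (ω : WienerPair) :
    sdeSolMap Y v₁ v₂ (s + t) x (pairPath ω) =
      sdeSolMap Y v₁ v₂ t (sdeSolMap Y v₁ v₂ s x (pairPath ω)) (pairShift s ω) := by
  unfold sdeSolMap
  rw [D.flow_add x (continuous_pairNoise _ _ _) (pairNoise_mem v₁ v₂ hv₁ hv₂ _) s.coe_nonneg ht]
  refine D.flow_congr _ ?_ (continuous_pairNoise _ _ _) (fun r => D.noise.sub_mem
      (pairNoise_mem v₁ v₂ hv₁ hv₂ _ _) (pairNoise_mem v₁ v₂ hv₁ hv₂ _ _))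
    (pairNoise_mem v₁ v₂ hv₁ hv₂ _) (fun r hr => (pairNoise_pairShift _ _ s ω hr.1).symm) ⟨ht, le_rfl⟩
  exact ((continuous_pairNoise _ _ _).comp (continuous_const_add _)).sub continuous_const

/-! ### The transition kernels -/

/-- **The transition kernel is the law of the solution map driven by the Brownian pair**:
`P_t(x, ·) = law(Φ_t(x, B))` (no junk). [folklore] -/
theorem sdeKernel_apply (t : ℝ≥0) (x : E) :
    sdeKernel Y v₁ v₂ t x = wienerPair.map fun ω => sdeSolMap Y v₁ v₂ t x (pairPath ω) := by
  rw [sdeKernel, dif_pos (D.measurable_sdeSolMap_pairPath hv₁ hv₂ t)]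
  rfl

/-- `P_t(x, A) = P{Φ_t(x, B) ∈ A}`. [folklore] -/
theorem sdeKernel_apply' (t : ℝ≥0) (x : E) {A : Set E} (hA : MeasurableSet A) :
    sdeKernel Y v₁ v₂ t x A = wienerPair ((fun ω => sdeSolMap Y v₁ v₂ t x (pairPath ω)) ⁻¹' A) := by
  rw [D.sdeKernel_apply hv₁ hv₂, Measure.map_apply (D.measurable_sdeSolMap_pairPath_right hv₁ hv₂ t x) hA]

/-- `P^t g(x) = E g(Φ_t(x, B))` for measurable `g ≥ 0` (Lebesgue integral). [folklore] -/
theorem lintegral_sdeKernel (t : ℝ≥0) (x : E) {g : E → ℝ≥0∞} (hg : Measurable g) :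
    ∫⁻ y, g y ∂(sdeKernel Y v₁ v₂ t x) = ∫⁻ ω, g (sdeSolMap Y v₁ v₂ t x (pairPath ω)) ∂wienerPair := by
  rw [D.sdeKernel_apply hv₁ hv₂, lintegral_map hg (D.measurable_sdeSolMap_pairPath_right hv₁ hv₂ t x)]

/-- `P^t g(x) = E g(Φ_t(x, B))` for (ae-strongly) measurable real `g` (Bochner integral).
[folklore] -/
theorem integral_sdeKernel (t : ℝ≥0) (x : E) {g : E → ℝ}
    (hg : AEStronglyMeasurable g (sdeKernel Y v₁ v₂ t x)) :
    ∫ y, g y ∂(sdeKernel Y v₁ v₂ t x) = ∫ ω, g (sdeSolMap Y v₁ v₂ t x (pairPath ω)) ∂wienerPair := by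
  rw [D.sdeKernel_apply hv₁ hv₂] at hg ⊢
  rw [integral_map (D.measurable_sdeSolMap_pairPath_right hv₁ hv₂ t x).aemeasurable hg]

/-- The transition kernels are Markov (probability) kernels: no explosion. [folklore] -/
theorem isMarkovKernel_sdeKernel (t : ℝ≥0) : IsMarkovKernel (sdeKernel Y v₁ v₂ t) := by
  refine ⟨fun x => ?_⟩
  rw [D.sdeKernel_apply hv₁ hv₂]
  exact Measure.isProbabilityMeasure_map (D.measurable_sdeSolMap_pairPath_right hv₁ hv₂ t x).aemeasurable

/-- The law of `Φ_t(x, ·)` under `wienerPair` in RAW path coordinates is the same kernel. [folklore] -/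
theorem sdeKernel_eq_map_sdeSolMap (t : ℝ≥0) (x : E) :
    sdeKernel Y v₁ v₂ t x = wienerPair.map (sdeSolMap Y v₁ v₂ t x) := by
  have h1 : Measurable (sdeSolMap Y v₁ v₂ t x) := by
    have h := (D.measurable_sdeSolMap hv₁ hv₂ t).comp (measurable_prodMk_left (x := x))
    exact h
  rw [D.sdeKernel_apply hv₁ hv₂]
  change Measure.map (sdeSolMap Y v₁ v₂ t x ∘ pairPath) wienerPair = _
  rw [← Measure.map_map h1 measurable_pairPath, map_pairPath_wienerPair]

/-- **Joint measurability** of `(t, x) ↦ P_t(x, ·)`. [folklore] -/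
theorem measurable_sdeKernel :
    Measurable fun p : ℝ≥0 × E => sdeKernel Y v₁ v₂ p.1 p.2 := by
  set F : (ℝ≥0 × E) × WienerPair → E := fun q => sdeSolMap Y v₁ v₂ q.1.1 q.1.2 (pairPath q.2) with hF
  have hFm : Measurable F := by
    have h1 : Measurable fun q : (ℝ≥0 × E) × WienerPair => ((q.1.1 : ℝ), (q.1.2, pairPath q.2)) :=
      (measurable_coe_nnreal_real.comp (measurable_fst.comp measurable_fst)).prodMk
        ((measurable_snd.comp measurable_fst).prodMk (measurable_pairPath.comp measurable_snd))
    have h := (D.measurable_uncurry_sdeSolMap hv₁ hv₂).comp h1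
    exact h
  refine Measure.measurable_of_measurable_coe _ fun A hA => ?_
  have h : (fun p : ℝ≥0 × E => sdeKernel Y v₁ v₂ p.1 p.2 A) = fun p => wienerPair (Prod.mk p ⁻¹' (F ⁻¹' A)) := by
    funext p
    rw [D.sdeKernel_apply' hv₁ hv₂ p.1 p.2 hA]
    rfl
  rw [h]
  exact measurable_measure_prodMk_left (hFm hA)

/-- `P_0 = id`: `Φ_0(x, B) = x`. [folklore] -/
theorem sdeKernel_zero : sdeKernel Y v₁ v₂ 0 = Kernel.id := by
  refine Kernel.ext fun x => ?_
  rw [D.sdeKernel_apply hv₁ hv₂, Kernel.id_apply]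
  have h : (fun ω : WienerPair => sdeSolMap Y v₁ v₂ ((0 : ℝ≥0) : ℝ) x (pairPath ω)) = fun _ => x :=
    funext fun ω => D.sdeSolMap_of_nonpos x _ (by simp)
  rw [h, Measure.map_const, measure_univ, one_smul]

/-- **The Feller property**: `x ↦ P^t g(x) = E g(Φ_t(x, B))` is continuous for bounded continuous `g`
(continuity of the flow in the initial condition and dominated convergence). [folklore] -/
theorem continuous_integral_sdeKernel (t : ℝ≥0) {g : E → ℝ} (hg : Continuous g) {C : ℝ}
    (hC : ∀ y, ‖g y‖ ≤ C) : Continuous fun x => ∫ y, g y ∂(sdeKernel Y v₁ v₂ t x) := by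
  have h : (fun x => ∫ y, g y ∂(sdeKernel Y v₁ v₂ t x)) =
      fun x => ∫ ω, g (sdeSolMap Y v₁ v₂ t x (pairPath ω)) ∂wienerPair := by
    funext x
    exact D.integral_sdeKernel hv₁ hv₂ t x hg.aestronglyMeasurable
  rw [h]
  refine continuous_of_dominated (bound := fun _ => C) (fun x => ?_) (fun x => ?_)
    (integrable_const C) ?_
  · exact (hg.measurable.comp (D.measurable_sdeSolMap_pairPath_right hv₁ hv₂ t x)).aestronglyMeasurable
  · exact Eventually.of_forall fun ω => hC _
  · exact Eventually.of_forall fun ω => hg.comp (D.continuous_sdeSolMap_left hv₁ hv₂ t (pairPath ω))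

/-- The Feller property for `g : E →ᵇ ℝ`. [folklore] -/
theorem continuous_integral_sdeKernel_bcf (t : ℝ≥0) (g : BoundedContinuousFunction E ℝ) :
    Continuous fun x => ∫ y, g y ∂(sdeKernel Y v₁ v₂ t x) :=
  D.continuous_integral_sdeKernel hv₁ hv₂ t g.continuous (fun y => g.norm_coe_le_norm y)

/-! ### The Chapman–Kolmogorov equation -/

/-- **The solution at time `s` is measurable with respect to the past of the Brownian pair up to
time `s`**: it is the flow driven by the noise STOPPED at `s`, a continuous path read off
`pairPast s ω`, and the flow on `[0, s]` only sees the noise on `[0, s]`. [folklore] -/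
theorem measurable_comap_pairPast_sdeSolMap (s : ℝ≥0) (x : E) :
    Measurable[MeasurableSpace.comap (pairPast s) inferInstance]
      fun ω : WienerPair => sdeSolMap Y v₁ v₂ s x (pairPath ω) := by
  -- the stopped noise `u ↦ n(min u s)`
  set G : WienerPair → ℝ → E := fun ω u => pairNoise v₁ v₂ (pairPath ω) (min u s) with hG
  have hGc : ∀ ω, Continuous (G ω) := fun ω =>
    (continuous_pairNoise _ _ (pairPath ω)).comp (continuous_id.min continuous_const)
  have hGS : ∀ ω u, G ω u ∈ D.noise := fun ω u => pairNoise_mem v₁ v₂ hv₁ hv₂ _ _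
  have hGm : ∀ u, Measurable[MeasurableSpace.comap (pairPast s) inferInstance] fun ω => G ω u := by
    intro u
    have hr : (min u (s : ℝ)).toNNReal ∈ Iic s := by
      have h := Real.toNNReal_le_toNNReal (min_le_right u (s : ℝ))
      rwa [Real.toNNReal_coe] at h
    -- `G ω u = B_r(ω₁) v₁ + B_r(ω₂) v₂`, `r = (min u s)⁺ ≤ s`, is read off `pairPast s ω`
    set g : (Iic s → ℝ) × (Iic s → ℝ) → E := fun q => q.1 ⟨_, hr⟩ • v₁ + q.2 ⟨_, hr⟩ • v₂ with hg
    have hgm : Measurable g :=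
      (((measurable_pi_apply _).comp measurable_fst).smul_const v₁).add
        (((measurable_pi_apply _).comp measurable_snd).smul_const v₂)
    have hfun : (fun ω => G ω u) = g ∘ pairPast s := by
      funext ω
      simp only [hG, hg, Function.comp_apply, pairNoise_pairPath]
      rfl
    rw [hfun]
    exact hgm.comp (comap_measurable (pairPast s))
  have hflow := D.measurable_flow (mΩ := MeasurableSpace.comap (pairPast s) inferInstance)
    (X := fun _ : WienerPair => x) measurable_const hGc hGS hGm s
  -- the stopped noise drives the same flow on `[0, s]`
  have heq : (fun ω : WienerPair => sdeSolMap Y v₁ v₂ s x (pairPath ω)) = fun ω => drivenFlow Y x (G ω) s := by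
    funext ω
    unfold sdeSolMap
    refine D.flow_congr x (continuous_pairNoise _ _ _) (hGc ω) (pairNoise_mem v₁ v₂ hv₁ hv₂ _)
      (hGS ω) (fun u hu => ?_) ⟨s.coe_nonneg, le_rfl⟩
    simp only [hG, min_eq_left hu.2]
  rw [heq]
  exact hflow

/-- **The Chapman–Kolmogorov equation** `P_{s+t} = P_t ∘ₖ P_s` for the transition kernels: the
cocycle property of the pathwise flow through the shifted Brownian pair, the measurability of
`Φ_s(x, B)` with respect to the past, and the weak Markov property of the pair of independent
Brownian motions (`Literature.Probability.Process.lintegral_comp_pairShift_eq`). [folklore] -/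
theorem sdeKernel_add (s t : ℝ≥0) :
    sdeKernel Y v₁ v₂ (s + t) = sdeKernel Y v₁ v₂ t ∘ₖ sdeKernel Y v₁ v₂ s := by
  classical
  refine Kernel.ext fun x => Measure.ext fun A hA => ?_
  set F : E × WienerPair → E := fun p => sdeSolMap Y v₁ v₂ t p.1 p.2 with hF
  have hFm : Measurable F := D.measurable_sdeSolMap hv₁ hv₂ t
  set G : E × WienerPair → ℝ≥0∞ := (F ⁻¹' A).indicator 1 with hG
  have hGm : Measurable G := measurable_one.indicator (hFm hA)
  set ξ : WienerPair → E := fun ω => sdeSolMap Y v₁ v₂ s x (pairPath ω) with hξ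
  have hξF : Measurable[MeasurableSpace.comap (pairPast s) inferInstance] ξ :=
    D.measurable_comap_pairPast_sdeSolMap hv₁ hv₂ s x
  -- left-hand side: the cocycle property
  have hL : sdeKernel Y v₁ v₂ (s + t) x A = ∫⁻ ω, G (ξ ω, pairShift s ω) ∂wienerPair := by
    rw [D.sdeKernel_apply' hv₁ hv₂ (s + t) x hA,
      ← lintegral_indicator_one ((D.measurable_sdeSolMap_pairPath_right hv₁ hv₂ _ x) hA)]
    refine lintegral_congr fun ω => ?_
    simp only [hG, hF, hξ, Set.indicator_apply, Set.mem_preimage, NNReal.coe_add, Pi.one_apply]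
    rw [D.sdeSolMap_add_pairPath hv₁ hv₂ s t.coe_nonneg x ω]
  -- right-hand side
  have hR : (sdeKernel Y v₁ v₂ t ∘ₖ sdeKernel Y v₁ v₂ s) x A =
      ∫⁻ ω, ∫⁻ ω', G (ξ ω, pairPath ω') ∂wienerPair ∂wienerPair := by
    rw [Kernel.comp_apply' _ _ _ hA, D.lintegral_sdeKernel hv₁ hv₂ s x (Kernel.measurable_coe _ hA)]
    refine lintegral_congr fun ω => ?_
    rw [D.sdeKernel_apply' hv₁ hv₂ t _ hA,
      ← lintegral_indicator_one ((D.measurable_sdeSolMap_pairPath_right hv₁ hv₂ _ _) hA)]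
    refine lintegral_congr fun ω' => ?_
    simp only [hG, hF, hξ, Set.indicator_apply, Set.mem_preimage, Pi.one_apply]
  rw [hL, hR]
  exact lintegral_comp_pairShift_eq s hξF hGm

end ConfinedDrift

end Literature.MathematicalPhysics.KineticTheory
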